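import Literature.AnabelianGeometry.EtaleTheta.ThetaSubquotientOfTempered
import Literature.AnabelianGeometry.SemiGraphs.TemperoidsResProofs
import Mathlib.Topology.Algebra.ContinuousMonoidHom

/-!
# [EtTh] §5: the theta subquotients `(l·Δ_Θ)_E` over `B^temp(Π)⁰` are «preserved by arbitrary self-equivalences of `D`» —
# the TWIST of abc-iut-L2-t9's carrier along a topological automorphism of `Π` compatible with `(q, ι)`

Mochizuki, *The étale theta function and its Frobenioid-theoretic manifestations*, Publ. RIMS **45** (2009), §5 p.327
(PDF p.101): «recall the characteristic [cf. Propositions 2.4, 2.6] subquotients `Π^tp_X ↠ (Π^tp_X)^Θ`; `l·Δ_Θ ⊆ (Π^tp_X)^Θ` … for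
`D ∈ Ob(D)`, these subquotients determine subquotients `Aut_D(D) ↠ Aut^Θ_D(D)`; `(l·Δ_Θ)_D ⊆ Aut^Θ_D(D)` which are preserved by
arbitrary self-equivalences of `D`»; Thm. 5.6 proof p.329 (PDF p.103) l.1 «it follows from Propositions 2.4, 2.6 that `Ψ` preserves
"`(l·Δ_Θ)_{(−)}`"» [cite: MochizukiEtTh2009, §5 p.327 (PDF p.101)].  S. Mochizuki, *Semi-graphs of anabelioids* (2006), Prop. 3.2 p.35
(a self-equivalence of `B^temp(Π)⁰` is `B^temp(φ)` for a topological automorphism `φ`; tree: `BTemp.exists_res_iso_of_connectedPart_equivalence`).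

abc-iut cell, layer L2, seat abc-iut-w5-d013 (gen 4), ROW «T56-L03 step 1» (STATUS 2026-08-26T09:47:05Z).  CLASS (b) CONSTRUCTION file
(abc-iut-L2-lead DEFS-FREEZE rules 04:46:23Z): new definitions over abc-iut-L2-t9's EXISTING carrier `ThetaSubquotient.LDelta q ι E`
(`ThetaSubquotientOfTempered.lean`, untouched), no field added to any structure, no instance, no notation, no new named Prop fact.

abc-iut-L2-t9's `thetaSubquotientStub q ι` transports `(l·Δ_Θ)_E` along MORPHISMS of `B^temp(Π)⁰` only (`ThetaSubquotient.map`).  A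
self-equivalence `Ψ^bs ≅ B^temp(φ)` relates `E` and `B^temp(φ)(E)` — the same `Π`-set with the action twisted by `φ` — which are not
joined by a morphism unless `φ` is inner; the «preservation» of print is the present TWIST.  Data: a topological automorphism
`φ : Π ≃ₜ* Π` and automorphisms `φQ` of `Q` («`(Π^tp_X)^Θ`»), `φΛ` of `Λ` («`l·Δ_Θ`», at level `N`: `μ_N`) with `q ∘ φ = φQ ∘ q` and
`ι ∘ φΛ = φQ ∘ ι` — the compatibility «`φ` preserves `Ker(Π^tp_X ↠ (Π^tp_X)^Θ)` and `l·Δ_Θ`» of Cor. 2.18 (i) / Props. 2.4, 2.6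
(tree: `RigidData.Cor218_i`, by name elsewhere; nothing of it is assumed here).
* `ThetaSubquotient.stabilizerSubgroup_res` — `Stab_{B^temp(φ)(E)}(x) = φ⁻¹(Stab_E(x))`;
* `ThetaSubquotient.killQ_comap_equiv` — `J(φ⁻¹ S) = φQ⁻¹ J(S)` for the killed subgroup `J(S) = (q(S) ∩ L)·[L, q(S)]`;
* `ThetaSubquotient.mem_fam_res_iff` / `mem_null_res_iff` — `t` is a compatible (resp. null) family on `B^temp(φ)(E)` iff `φΛ ∘ t`
  is one on `E`;
* `ThetaSubquotient.twistFam` (`Fam E ≃* Fam(B^temp(φ)E)`, `t ↦ φΛ⁻¹ ∘ t`), `map_twistFam_null`, and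
  **`ThetaSubquotient.twist q ι φ φQ φΛ hq hι E : LDelta q ι E ≃* LDelta q ι ((BTemp.res φ).obj E)`**, `[t] ↦ [φΛ⁻¹ ∘ t]`
  (`twist_mk`, `twist_symm_mk`);
* `ThetaSubquotient.map_twist` — NATURALITY: for a morphism `f : E → E′` of connected objects,
  `map (B^temp(φ) f) ∘ twist_E = twist_{E′} ∘ map f` (preimage-independence, abc-iut-L2-t9's `famPush_apply_congr`).
Step 2 (separate, proof-only, after the (Q,P) v-next packaging G-w4d042g3-1): the Δ-transport `aΨ` of [EtTh] Thm. 5.6 (abc-iut-L2-d4's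
DATA binder) at the genuine §5 data := `twist` along the [SemiAnbd] Prop. 3.2 automorphism of `Ψ^bs`, read through
`(Ψ A)^bs ≅ Ψ^bs(A^bs) ≅ B^temp(φ)(A^bs)`, and T56-L09c.  HONEST FRAMING: definitions + kernel-checked lemmas about abc-iut-L2-t9's
carrier; nothing about the curves of [EtTh] is asserted; no side taken on [IUTchIII] Cor. 3.12.
-/

noncomputable section

namespace Literature.AnabelianGeometry.EtaleTheta

namespace ThetaSubquotient

open CategoryTheory Literature.AlgebraicGeometry.Frobenioids Literature.AnabelianGeometry.SemiGraphs
open Literature.AlgebraicGeometry.Frobenioids.QuasiTemperoid (stabilizerSubgroup)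

universe u v w

variable {G : Type u} [Group G] [TopologicalSpace G] [IsTopologicalGroup G] {Q : Type v} [Group Q] {Λ : Type w}
  [CommGroup Λ] (q : G →* Q) (ι : Λ →* Q)
  (φ : G ≃ₜ* G) (φQ : Q ≃* Q) (φΛ : Λ ≃* Λ) (hq : ∀ g : G, q (φ g) = φQ (q g)) (hι : ∀ a : Λ, ι (φΛ a) = φQ (ι a))

/-! ### Stabilisers and killed subgroups under the twist -/

omit [IsTopologicalGroup G] in
/-- `Stab_{B^temp(φ)(E)}(x) = φ⁻¹(Stab_E(x))` (definitionally). [cite: MochizukiSemiAnbd2006, Rmk 3.1.2 p.33] -/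
theorem stabilizerSubgroup_res (E : BTemp G) (x : E.obj.V) :
    stabilizerSubgroup ((BTemp.res (φ : G →ₜ* G)).obj E) x = (stabilizerSubgroup E x).comap φ.toMonoidHom := by
  ext g
  rfl

include hι in
/-- `φQ` stabilises `L = ι(Λ)`. [cite: MochizukiEtTh2009, §5 p.327 (PDF p.101)] -/
theorem map_range_eq : ι.range.map φQ.symm.toMonoidHom = ι.range := by
  ext x
  rw [Subgroup.mem_map_equiv, MulEquiv.symm_symm]
  constructor
  · rintro ⟨a, ha⟩
    refine ⟨φΛ.symm a, ?_⟩
    apply φQ.injective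
    rw [← hι, MulEquiv.apply_symm_apply, ha]
  · rintro ⟨a, rfl⟩
    exact ⟨φΛ a, hι a⟩

include hq in
omit [IsTopologicalGroup G] in
/-- `q(φ⁻¹ S) = φQ⁻¹ q(S)`. [cite: MochizukiEtTh2009, §5 p.327 (PDF p.101)] -/
theorem map_comap_eq (S : Subgroup G) :
    (S.comap φ.toMonoidHom).map q = (S.map q).map φQ.symm.toMonoidHom := by
  ext x
  simp only [Subgroup.mem_map, Subgroup.mem_comap, MulEquiv.coe_toMonoidHom]
  constructor
  · rintro ⟨g, hg, rfl⟩
    refine ⟨q (φ g), ⟨φ g, hg, rfl⟩, ?_⟩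
    rw [hq, MulEquiv.symm_apply_apply]
  · rintro ⟨_, ⟨s, hs, rfl⟩, rfl⟩
    refine ⟨φ.symm s, ?_, ?_⟩
    · change φ (φ.symm s) ∈ S
      rwa [ContinuousMulEquiv.apply_symm_apply]
    · apply φQ.injective
      have h := hq (φ.symm s)
      rw [ContinuousMulEquiv.apply_symm_apply] at h
      rw [MulEquiv.apply_symm_apply, ← h]

include hq hι in
omit [IsTopologicalGroup G] in
/-- **`J(φ⁻¹ S) = φQ⁻¹ J(S)`** for `J(S) = (q(S) ∩ L)·[L, q(S)]`. [cite: MochizukiEtTh2009, §5 p.327 (PDF p.101)] -/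
theorem killQ_comap_equiv (S : Subgroup G) :
    killQ q ι (S.comap φ.toMonoidHom) = (killQ q ι S).comap φQ.toMonoidHom := by
  rw [killQ, killQ, map_comap_eq q φ φQ hq, Subgroup.comap_equiv_eq_map_symm', Subgroup.map_sup,
    Subgroup.map_commutator, Subgroup.map_inf_eq _ _ _ φQ.symm.injective, map_range_eq ι φQ φΛ hι]

include hq hι in
omit [IsTopologicalGroup G] in
/-- Membership form: `x ∈ J(Stab_{B^temp(φ)E}(y)) ↔ φQ x ∈ J(Stab_E(y))`. [cite: MochizukiEtTh2009, §5 p.327 (PDF p.101)] -/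
theorem mem_killQ_res_iff (E : BTemp G) (y : E.obj.V) (x : Q) :
    x ∈ killQ q ι (stabilizerSubgroup ((BTemp.res (φ : G →ₜ* G)).obj E) y) ↔ φQ x ∈ killQ q ι (stabilizerSubgroup E y) := by
  rw [stabilizerSubgroup_res, killQ_comap_equiv q ι φ φQ φΛ hq hι, Subgroup.mem_comap, MulEquiv.coe_toMonoidHom]

/-! ### Families under the twist -/

omit [IsTopologicalGroup G] in
/-- The null-family condition on `B^temp(φ)(E)`, unfolded over `E` (definitional). [cite: MochizukiEtTh2009, §5 p.327 (PDF p.101)] -/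
theorem mem_null_res_iff' (E : BTemp G) (t : E.obj.V → Λ) :
    t ∈ Null q ι ((BTemp.res (φ : G →ₜ* G)).obj E) ↔
      ∀ x : E.obj.V, ι (t x) ∈ killQ q ι (stabilizerSubgroup ((BTemp.res (φ : G →ₜ* G)).obj E) x) :=
  Iff.rfl

omit [IsTopologicalGroup G] in
/-- The compatible-family condition on `B^temp(φ)(E)`, unfolded over `E` (definitional: the action of `g` on `B^temp(φ)(E)` is that
of `φ g` on `E`). [cite: MochizukiEtTh2009, §5 p.327 (PDF p.101)] -/
theorem mem_fam_res_iff' [ι.range.Normal] (E : BTemp G) (t : E.obj.V → Λ) :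
    t ∈ Fam q ι ((BTemp.res (φ : G →ₜ* G)).obj E) ↔ ∀ (g : G) (x : E.obj.V),
      (ι (t (E.obj.ρ (φ g) x)))⁻¹ * (q g * ι (t x) * (q g)⁻¹) ∈
        killQ q ι (stabilizerSubgroup ((BTemp.res (φ : G →ₜ* G)).obj E) (E.obj.ρ (φ g) x)) :=
  Iff.rfl

include hq hι in
omit [IsTopologicalGroup G] in
/-- **A function is a NULL family on `B^temp(φ)(E)` iff `φΛ ∘ t` is null on `E`.** [cite: MochizukiEtTh2009, §5 p.327 (PDF p.101)] -/
theorem mem_null_res_iff (E : BTemp G) (t : E.obj.V → Λ) :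
    t ∈ Null q ι ((BTemp.res (φ : G →ₜ* G)).obj E) ↔ (fun x => φΛ (t x)) ∈ Null q ι E := by
  rw [mem_null_res_iff', mem_null_iff]
  refine forall_congr' fun x => ?_
  rw [mem_killQ_res_iff q ι φ φQ φΛ hq hι, hι]

include hq hι in
omit [IsTopologicalGroup G] in
/-- **A function is a COMPATIBLE family on `B^temp(φ)(E)` iff `φΛ ∘ t` is compatible on `E`** (`φ` surjective: the condition at
`(g, x)` on `B^temp(φ)(E)` is `φQ⁻¹` of the condition at `(φ g, x)` on `E`). [cite: MochizukiEtTh2009, §5 p.327 (PDF p.101)] -/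
theorem mem_fam_res_iff [ι.range.Normal] (E : BTemp G) (t : E.obj.V → Λ) :
    t ∈ Fam q ι ((BTemp.res (φ : G →ₜ* G)).obj E) ↔ (fun x => φΛ (t x)) ∈ Fam q ι E := by
  rw [mem_fam_res_iff', mem_fam_iff]
  have key : ∀ (g : G) (x : E.obj.V),
      ((ι (t (E.obj.ρ (φ g) x)))⁻¹ * (q g * ι (t x) * (q g)⁻¹) ∈
          killQ q ι (stabilizerSubgroup ((BTemp.res (φ : G →ₜ* G)).obj E) (E.obj.ρ (φ g) x)) ↔
        (ι (φΛ (t (E.obj.ρ (φ g) x))))⁻¹ * (q (φ g) * ι (φΛ (t x)) * (q (φ g))⁻¹) ∈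
          killQ q ι (stabilizerSubgroup E (E.obj.ρ (φ g) x))) := fun g x => by
    rw [mem_killQ_res_iff q ι φ φQ φΛ hq hι, map_mul, map_mul, map_mul, map_inv, map_inv, ← hq, ← hι, ← hι]
  constructor
  · intro h g x
    have h' := (key (φ.symm g) x).1 (h (φ.symm g) x)
    simpa only [ContinuousMulEquiv.apply_symm_apply] using h'
  · intro h g x
    exact (key g x).2 (h (φ g) x)

variable [ι.range.Normal]

include hq hι in
/-- **The twist on compatible families** `Fam E ≃* Fam(B^temp(φ)E)`, `t ↦ φΛ⁻¹ ∘ t` (inverse `s ↦ φΛ ∘ s`).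
[cite: MochizukiEtTh2009, §5 p.327 (PDF p.101)] -/
def twistFam (E : BTemp G) : Fam q ι E ≃* Fam q ι ((BTemp.res (φ : G →ₜ* G)).obj E) where
  toFun t := ⟨fun x => φΛ.symm ((t : E.obj.V → Λ) x), (mem_fam_res_iff q ι φ φQ φΛ hq hι E _).2 (by
    simpa only [MulEquiv.apply_symm_apply] using t.2)⟩
  invFun s := ⟨fun x => φΛ (s.1 x), (mem_fam_res_iff q ι φ φQ φΛ hq hι E _).1 s.2⟩
  left_inv t := by
    ext x
    exact φΛ.apply_symm_apply _
  right_inv s := by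
    ext x
    exact φΛ.symm_apply_apply _
  map_mul' t s := by
    ext x
    exact map_mul φΛ.symm _ _

omit [IsTopologicalGroup G] in
/-- `twistFam` on functions. [cite: MochizukiEtTh2009, §5 p.327 (PDF p.101)] -/
theorem coe_twistFam (E : BTemp G) (t : Fam q ι E) (x : E.obj.V) :
    (twistFam q ι φ φQ φΛ hq hι E t).1 x = φΛ.symm ((t : E.obj.V → Λ) x) := rfl

omit [IsTopologicalGroup G] in
/-- `twistFam⁻¹` on functions. [cite: MochizukiEtTh2009, §5 p.327 (PDF p.101)] -/
theorem coe_twistFam_symm (E : BTemp G) (s : Fam q ι ((BTemp.res (φ : G →ₜ* G)).obj E)) (x : E.obj.V) :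
    ((twistFam q ι φ φQ φΛ hq hι E).symm s).1 x = φΛ (s.1 x) := rfl

omit [IsTopologicalGroup G] in
/-- `twistFam` carries the null families onto the null families. [cite: MochizukiEtTh2009, §5 p.327 (PDF p.101)] -/
theorem map_twistFam_null (E : BTemp G) :
    ((Null q ι E).subgroupOf (Fam q ι E)).map (twistFam q ι φ φQ φΛ hq hι E).toMonoidHom =
      (Null q ι ((BTemp.res (φ : G →ₜ* G)).obj E)).subgroupOf (Fam q ι ((BTemp.res (φ : G →ₜ* G)).obj E)) := by
  ext s
  rw [Subgroup.mem_map_equiv, Subgroup.mem_subgroupOf, Subgroup.mem_subgroupOf]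
  exact (mem_null_res_iff q ι φ φQ φΛ hq hι E s.1).symm

include hq hι in
/-- **The twist `(l·Δ_Θ)_E ⥲ (l·Δ_Θ)_{B^temp(φ)(E)}`** along a topological automorphism `φ` of `Π` compatible with `(q, ι)` through
`(φQ, φΛ)`: «`(l·Δ_Θ)_D` … preserved by arbitrary self-equivalences of `D`» ([SemiAnbd] Prop. 3.2: a self-equivalence of
`B^temp(Π)⁰` is `B^temp(φ)`).  On classes: `[t] ↦ [φΛ⁻¹ ∘ t]`. [cite: MochizukiEtTh2009, §5 p.327 (PDF p.101)] -/
def twist (E : BTemp G) : LDelta q ι E ≃* LDelta q ι ((BTemp.res (φ : G →ₜ* G)).obj E) :=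
  QuotientGroup.congr _ _ (twistFam q ι φ φQ φΛ hq hι E) (map_twistFam_null q ι φ φQ φΛ hq hι E)

omit [IsTopologicalGroup G] in
/-- `twist` on classes. [cite: MochizukiEtTh2009, §5 p.327 (PDF p.101)] -/
@[simp] theorem twist_mk (E : BTemp G) (t : Fam q ι E) :
    twist q ι φ φQ φΛ hq hι E (mk q ι E t) = mk q ι _ (twistFam q ι φ φQ φΛ hq hι E t) := rfl

omit [IsTopologicalGroup G] in
/-- `twist⁻¹` on classes. [cite: MochizukiEtTh2009, §5 p.327 (PDF p.101)] -/
@[simp] theorem twist_symm_mk (E : BTemp G) (s : Fam q ι ((BTemp.res (φ : G →ₜ* G)).obj E)) :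
    (twist q ι φ φQ φΛ hq hι E).symm (mk q ι _ s) = mk q ι E ((twistFam q ι φ φQ φΛ hq hι E).symm s) := rfl

/-! ### Naturality along morphisms of connected objects -/

omit [IsTopologicalGroup G] in
/-- **NATURALITY of the twist**: for a morphism `f : E → E′` of connected objects of `B^temp(Π)`,
`map (B^temp(φ) f) ∘ twist_E = twist_{E′} ∘ map f` — both sides evaluate a representative at some preimage under `f`, and the class
does not depend on that choice (abc-iut-L2-t9's `famPush_apply_congr`). [cite: MochizukiEtTh2009, §5 p.327 (PDF p.101)] -/
theorem map_twist {E E' : BTemp G} (hE : IsConnectedObj E) (hE' : IsConnectedObj E') (f : E ⟶ E')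
    (hEr : IsConnectedObj ((BTemp.res (φ : G →ₜ* G)).obj E)) (hE'r : IsConnectedObj ((BTemp.res (φ : G →ₜ* G)).obj E'))
    (x : LDelta q ι E) :
    map q ι hEr hE'r ((BTemp.res (φ : G →ₜ* G)).map f) (twist q ι φ φQ φΛ hq hι E x) =
      twist q ι φ φQ φΛ hq hι E' (map q ι hE hE' f x) := by
  induction x using QuotientGroup.induction_on with
  | H t =>
    change map q ι hEr hE'r _ (mk q ι _ (twistFam q ι φ φQ φΛ hq hι E t)) =
      twist q ι φ φQ φΛ hq hι E' (mk q ι _ (famPush q ι hE hE' f t))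
    rw [map_mk, twist_mk, mk_eq_mk_iff]
    -- the same statement with every point read in `E`, `E'` (the twisted objects have the same underlying sets)
    have aux : ∀ y : E'.obj.V,
        (ι (φΛ.symm ((t : E.obj.V → Λ)
            (pre (E := (BTemp.res (φ : G →ₜ* G)).obj E) (E' := (BTemp.res (φ : G →ₜ* G)).obj E') hEr hE'r
              ((BTemp.res (φ : G →ₜ* G)).map f) y))))⁻¹ *
          ι (φΛ.symm ((famPush q ι hE hE' f t : E'.obj.V → Λ) y)) ∈
            killQ q ι ((stabilizerSubgroup E' y).comap φ.toMonoidHom) := by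
      intro y
      -- `x₀` := the preimage of `y` chosen on the twisted side; it lies over `y`
      generalize hx : pre (E := (BTemp.res (φ : G →ₜ* G)).obj E) (E' := (BTemp.res (φ : G →ₜ* G)).obj E') hEr hE'r
        ((BTemp.res (φ : G →ₜ* G)).map f) y = x₀
      have hy : (f.hom.hom x₀ : E'.obj.V) = y := by
        rw [← hx]
        exact apply_pre hEr hE'r ((BTemp.res (φ : G →ₜ* G)).map f) y
      subst hy
      rw [killQ_comap_equiv q ι φ φQ φΛ hq hι, Subgroup.mem_comap, MulEquiv.coe_toMonoidHom, map_mul, map_inv, ← hι, ← hι,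
        MulEquiv.apply_symm_apply, MulEquiv.apply_symm_apply]
      -- independence of the preimage (abc-iut-L2-t9)
      have key := (killQ q ι _).inv_mem (famPush_apply_congr q ι hE hE' f t x₀)
      rwa [mul_inv_rev, inv_inv] at key
    exact aux

end ThetaSubquotient

end Literature.AnabelianGeometry.EtaleTheta

end
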